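import Mathlib
import Literature.Probability.Percolation.MinOpenCut
import Literature.Probability.Percolation.SiteConnectionTools
import Summits.CriticalPhenomena.PercolationContinuityZ3.Theorems.PercBudgetLadderPinholeClosingPocketTwoPockets
import Summits.CriticalPhenomena.PercolationContinuityZ3.Theorems.PinholeClosing.Negative.PinholeClosingResistance
import HarnessLib

/-!
# Crux `PercBudgetLadder.PinholeClosing` (stmt-CriticalPhenomena-5249), line `budget-halving` (shell form) — the deterministic core

Helper file of lead `prover-line-stmt-CriticalPhenomena-5249-c3-0` for the reshaped skeleton
`Cruxes/PinholeClosing/Lines/budget_halving.lean` (`--supports stmt-CriticalPhenomena-5249`); proves the registered stub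
`stub_blockedOfShell` and the bookkeeping lemmas the stub `stub_shellMerge` is assembled from.  Everything is
deterministic (lattice configurations `ω ⊆ E(ℤ³)`), in the tree's vocabulary (`box`, `innerBoundary`, `edgeBoundary`,
`openConnIn`, translates `(box 3 n).image (· + y)`, and `PocketResampling.openBdry ω U` = number of OPEN lattice
boundary edges of `U`).

* `door_lemma` (caps ⇒ pockets): if the translated window `box n + y → ∂ⁱⁿ box L + y` is blocked inside `box L + y`
  after closing `≤ j` edges, the set `U` of sites joined to `box n + y` by surviving open paths inside the window is a
  pocket: `box n + y ⊆ U ⊆ box L + y`, `U` misses the sink sphere, and `U` has `≤ j` open boundary edges.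
* `floor_cut` (floors in cut form): if the window `box m + y → ∂ⁱⁿ box L + y` can NOT be blocked by `j` closures, every
  finite `X ⊇ box m + y` missing the sink sphere has `≥ j + 1` open boundary edges.
* `openBdry_union_le`: submodularity of the open cut function (`PocketResampling.openBdry_submodular`) merges two
  pockets WITHOUT budget growth when their intersection contains a floor box (the row / face iterations live in the
  merge file of `stub_shellMerge`).
* `blocked_of_shell` / `stub_blockedOfShell` (the two-sided cut): a finite `V` with `≤ j` open boundary edges (`j ≥ 1`)
  containing a whole sup-norm sphere `{‖x‖∞ = R}`, disjoint from `box m` and inside `box (M-1)` (`m < R < M`), blocks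
  the centred annulus `box m → ∂ⁱⁿ box M` after closing `≤ j - 1` edges: the open doors of `V` whose outer endpoint
  lies inside the sphere and those whose outer endpoint lies outside are each a cutset (discrete intermediate value
  theorem on `‖·‖∞` along a lattice path), they are disjoint, so one class has `≤ ⌊j/2⌋ ≤ j - 1` edges.

No definitions, no probability; sources: folklore (max-flow/min-cut bookkeeping; submodularity of cut functions).
-/

noncomputable section

namespace Summit.CriticalPhenomena.PercolationContinuityZ3.Theorems

open MeasureTheory
open scoped Classical
open Literature.Probability.Percolation Literature.Probability.LatticeModels
open Summit.CriticalPhenomena.PercolationContinuityZ3.Theorems.PinholeClosing.Negative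
open Summit.CriticalPhenomena.PercolationContinuityZ3.Theorems.PocketResampling (openBdry openBdry_submodular
  mk_mem_edgeBoundary_iff)

namespace ShellExclusion

/-! ## Translates of boxes -/

/-- Membership in a translate `s + y` of a finite set of sites. -/
theorem mem_image_add_iff {s : Finset (Site 3)} {y v : Site 3} :
    v ∈ s.image (· + y) ↔ v - y ∈ s := by
  constructor
  · rintro h
    obtain ⟨x, hx, rfl⟩ := Finset.mem_image.1 h
    simpa using hx
  · intro h
    exact Finset.mem_image.2 ⟨v - y, h, sub_add_cancel v y⟩

/-- Two translated boxes are nested when the centres are close: if `|a i - b i| + m ≤ n` for every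
coordinate then `box m + a ⊆ box n + b`. -/
theorem image_add_box_subset_image_add_box {m n : ℕ} {a b : Site 3}
    (h : ∀ i, |a i - b i| + m ≤ n) : (box 3 m).image (· + a) ⊆ (box 3 n).image (· + b) := by
  intro v hv
  rw [mem_image_add_iff, mem_box] at hv ⊢
  intro i
  have h1 := hv i
  have h2 : |a i - b i| ≤ (n : ℤ) - m := by linarith [h i]
  simp only [Pi.sub_apply] at h1 ⊢
  rw [abs_le] at h2
  constructor <;> omega

/-- Lattice neighbours move each coordinate by at most one. -/
theorem abs_sub_le_one_of_adj {u v : Site 3} (h : (zdGraph 3).Adj u v) (i : Fin 3) : |u i - v i| ≤ 1 := by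
  rw [zdGraph_adj_iff] at h
  obtain ⟨j, hj | hj⟩ := h
  · have : v i = u i + (Pi.single j (1 : ℤ) : Site 3) i := by rw [hj]; rfl
    rcases eq_or_ne i j with rfl | hij
    · simp at this; rw [abs_le]; omega
    · simp [hij] at this; rw [abs_le]; omega
  · have : u i = v i + (Pi.single j (1 : ℤ) : Site 3) i := by rw [hj]; rfl
    rcases eq_or_ne i j with rfl | hij
    · simp at this; rw [abs_le]; omega
    · simp [hij] at this; rw [abs_le]; omega

/-- A lattice neighbour of a site of `box (R - 1)` lies in `box R`. -/
theorem mem_box_of_adj_of_mem_box_pred {R : ℕ} (hR : 1 ≤ R) {u v : Site 3} (hu : u ∈ box 3 (R - 1))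
    (h : (zdGraph 3).Adj u v) : v ∈ box 3 R := by
  rw [mem_box] at hu ⊢
  intro i
  have h1 := hu i
  have h2 := abs_sub_le_one_of_adj h i
  rw [abs_le] at h2
  have : ((R - 1 : ℕ) : ℤ) = (R : ℤ) - 1 := by omega
  constructor <;> omega

/-- A lattice neighbour of a site outside `box R` lies outside `box (R - 1)` (`1 ≤ R`). -/
theorem not_mem_box_pred_of_adj_of_not_mem_box {R : ℕ} (hR : 1 ≤ R) {u v : Site 3} (hu : u ∉ box 3 R)
    (h : (zdGraph 3).Adj u v) : v ∉ box 3 (R - 1) := by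
  intro hv
  apply hu
  rw [mem_box] at hv ⊢
  intro i
  have h1 := hv i
  have h2 := abs_sub_le_one_of_adj h i
  rw [abs_le] at h2
  have : ((R - 1 : ℕ) : ℤ) = (R : ℤ) - 1 := by omega
  constructor <;> omega

/-- A site of `box L` off its inner vertex boundary has all its lattice neighbours in `box L`. -/
theorem mem_box_of_adj_of_not_mem_innerBoundary {L : ℕ} {u v : Site 3} (hu : u ∈ box 3 L)
    (hu' : u ∉ innerBoundary (zdGraph 3) (box 3 L)) (h : (zdGraph 3).Adj u v) : v ∈ box 3 L := by
  by_contra hv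
  exact hu' (mem_innerBoundary_iff.2 ⟨hu, v, hv, h⟩)

/-- Translated version: a site of `box L + y` off `∂ⁱⁿ box L + y` has all its lattice neighbours in `box L + y`. -/
theorem mem_image_of_adj_of_not_mem_image_innerBoundary {L : ℕ} {y u v : Site 3}
    (hu : u ∈ (box 3 L).image (· + y)) (hu' : u ∉ (innerBoundary (zdGraph 3) (box 3 L)).image (· + y))
    (h : (zdGraph 3).Adj u v) : v ∈ (box 3 L).image (· + y) := by
  rw [mem_image_add_iff] at hu hu' ⊢
  refine mem_box_of_adj_of_not_mem_innerBoundary hu hu' ?_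
  have : (zdGraph 3).Adj (Site.shift (-y) u) (Site.shift (-y) v) := (zdGraph_adj_shift_iff (-y) u v).2 h
  simpa [sub_eq_add_neg] using this

/-- A site of `box L` off its inner vertex boundary lies in `box (L - 1)`. -/
theorem mem_box_pred_of_not_mem_innerBoundary {L : ℕ} {u : Site 3} (hu : u ∈ box 3 L)
    (hu' : u ∉ innerBoundary (zdGraph 3) (box 3 L)) : u ∈ box 3 (L - 1) := by
  rw [mem_box] at hu ⊢
  intro i
  have h1 := hu i
  by_contra hcon
  apply hu'
  rw [mem_innerBoundary_iff]
  refine ⟨mem_box.2 hu, ?_⟩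
  have hi : u i = L ∨ u i = -L := by omega
  rcases hi with hi | hi
  · refine ⟨u + Pi.single i 1, ?_, (zdGraph_adj_iff _ _).2 ⟨i, Or.inl rfl⟩⟩
    rw [mem_box, not_forall]
    exact ⟨i, by simp [hi]⟩
  · refine ⟨u - Pi.single i 1, ?_, (zdGraph_adj_iff _ _).2 ⟨i, Or.inr (by simp)⟩⟩
    rw [mem_box, not_forall]
    exact ⟨i, by simp [hi]⟩


/-! ## Pockets: caps give few open doors, floors give many -/

/-- Paths of `ω ∖ S` inside a region `F` that start in `X` stay in `X` when every open lattice
boundary edge of `X` lies in `S` (lattice configurations).  (General-region copy of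
`PocketResampling.stays_of_boundary_subset`.) -/
theorem stays_of_boundary_subset {F : Set (Site 3)} {X : Finset (Site 3)} {ω : BondConfig (Site 3)}
    {S : Finset (Sym2 (Site 3))} (hω : ω ⊆ (zdGraph 3).edgeSet)
    (hS : ∀ e ∈ edgeBoundary (zdGraph 3) X, e ∈ ω → e ∈ S) (u v : F)
    (huv : ((openGraph (ω \ ↑S)).induce F).Reachable u v) (hu : (u : Site 3) ∈ X) :
    (v : Site 3) ∈ X := by
  rw [SimpleGraph.reachable_iff_reflTransGen] at huv
  induction huv with
  | refl => exact hu
  | @tail b c _ hbc ih =>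
    simp only [SimpleGraph.induce_adj, openGraph_adj, Set.mem_sdiff, Finset.mem_coe] at hbc
    obtain ⟨⟨hopen, hnotS⟩, _⟩ := hbc
    by_contra hc
    exact hnotS (hS _ ((mem_edgeBoundary_iff).2
      ⟨hω hopen, ⟨(b : Site 3), ih, Sym2.mem_mk_left _ _⟩, ⟨(c : Site 3), hc, Sym2.mem_mk_right _ _⟩⟩)
      hopen)

/-- **Door lemma (caps ⇒ pockets).**  If the translated window `box n + y → ∂ⁱⁿ box L + y` can be blocked
inside `box L + y` by closing a set `S` of at most `j` edges, then the set `U` of sites joined to `box n + y`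
by `(ω ∖ S)`-open paths inside the window is a POCKET: it contains `box n + y`, lies in the window off its
sink sphere, and has at most `j` open lattice boundary edges (they all belong to `S`: the outer endpoint of an
open boundary edge not in `S` would be reachable, because a site off the sink sphere has all its lattice
neighbours inside the window). -/
theorem door_lemma {j n L : ℕ} {y : Site 3} {ω : BondConfig (Site 3)} (hnL : n ≤ L)
    (hcap : ∃ S : Finset (Sym2 (Site 3)), S.card ≤ j ∧ ¬ ∃ x ∈ (box 3 n).image (· + y),
      ∃ z ∈ (innerBoundary (zdGraph 3) (box 3 L)).image (· + y),
        (ω \ ↑S) ∈ openConnIn ↑((box 3 L).image (· + y)) x z) :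
    ∃ U : Finset (Site 3), (box 3 n).image (· + y) ⊆ U ∧ U ⊆ (box 3 L).image (· + y) ∧
      Disjoint U ((innerBoundary (zdGraph 3) (box 3 L)).image (· + y)) ∧ openBdry ω U ≤ j := by
  obtain ⟨S, hS, hb⟩ := hcap
  set F : Finset (Site 3) := (box 3 L).image (· + y) with hF
  set A : Finset (Site 3) := (box 3 n).image (· + y) with hA
  set B : Finset (Site 3) := (innerBoundary (zdGraph 3) (box 3 L)).image (· + y) with hB
  set U : Finset (Site 3) := F.filter (fun v => ∃ x ∈ A, (ω \ ↑S) ∈ openConnIn (↑F : Set (Site 3)) x v)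
    with hU
  have hAF : A ⊆ F := by
    intro x hx
    rw [hA, mem_image_add_iff] at hx
    rw [hF, mem_image_add_iff]
    exact box_mono 3 hnL hx
  have hAU : A ⊆ U := by
    intro x hx
    refine Finset.mem_filter.2 ⟨hAF hx, x, hx, ?_⟩
    exact ⟨Finset.mem_coe.2 (hAF hx), Finset.mem_coe.2 (hAF hx), SimpleGraph.Reachable.refl _⟩
  have hUB : Disjoint U B := by
    rw [Finset.disjoint_left]
    intro v hvU hvB
    obtain ⟨-, x, hx, hconn⟩ := Finset.mem_filter.1 hvU
    exact hb ⟨x, hx, v, hvB, hconn⟩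
  have key : ∀ u v, u ∈ U → v ∉ U → s(u, v) ∈ (zdGraph 3).edgeSet → s(u, v) ∈ ω → s(u, v) ∈ S := by
    intro u v hu hv hE heω
    by_contra heS
    have hadj : (zdGraph 3).Adj u v := hE
    obtain ⟨huF, x, hx, hconn⟩ := Finset.mem_filter.1 hu
    have huB : u ∉ B := fun huB => hb ⟨x, hx, u, huB, hconn⟩
    have hvF : v ∈ F := mem_image_of_adj_of_not_mem_image_innerBoundary huF huB hadj
    apply hv
    refine Finset.mem_filter.2 ⟨hvF, x, hx, ?_⟩
    obtain ⟨hxF', huF', hr⟩ := hconn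
    refine ⟨hxF', Finset.mem_coe.2 hvF, hr.trans (SimpleGraph.Adj.reachable ?_)⟩
    simp only [SimpleGraph.induce_adj, openGraph_adj, Set.mem_sdiff, Finset.mem_coe]
    exact ⟨⟨heω, heS⟩, hadj.ne⟩
  have hsub : (edgeBoundary (zdGraph 3) U).filter (· ∈ ω) ⊆ S := by
    intro e
    induction e using Sym2.ind with
    | h u v =>
      intro he
      rw [Finset.mem_filter] at he
      obtain ⟨hbd, heω⟩ := he
      have hE : s(u, v) ∈ (zdGraph 3).edgeSet := (mem_edgeBoundary_iff.1 hbd).1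
      rcases (mk_mem_edgeBoundary_iff hE).1 hbd with ⟨hu, hv⟩ | ⟨hu, hv⟩
      · exact key u v hu hv hE heω
      · have hE' : s(v, u) ∈ (zdGraph 3).edgeSet := by rwa [Sym2.eq_swap]
        have heω' : s(v, u) ∈ ω := by rwa [Sym2.eq_swap]
        have := key v u hv hu hE' heω'
        rwa [Sym2.eq_swap]
  refine ⟨U, hAU, Finset.filter_subset _ _, hUB, ?_⟩
  exact (Finset.card_le_card hsub).trans hS

/-- **Floors in cut form.**  If the translated window `box m + y → ∂ⁱⁿ box L + y` can NOT be blocked inside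
`box L + y` by closing `j` edges, then every finite set `X` containing `box m + y` and lying in the window off
its sink sphere has at least `j + 1` open lattice boundary edges (its open boundary is a blocking set, by
`stays_of_boundary_subset`; lattice configurations). -/
theorem floor_cut {j m L : ℕ} {y : Site 3} {ω : BondConfig (Site 3)} (hω : ω ⊆ (zdGraph 3).edgeSet)
    (hfloor : ¬ ∃ S : Finset (Sym2 (Site 3)), S.card ≤ j ∧ ¬ ∃ x ∈ (box 3 m).image (· + y),
      ∃ z ∈ (innerBoundary (zdGraph 3) (box 3 L)).image (· + y),
        (ω \ ↑S) ∈ openConnIn ↑((box 3 L).image (· + y)) x z)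
    {X : Finset (Site 3)} (hAX : (box 3 m).image (· + y) ⊆ X)
    (hXB : Disjoint X ((innerBoundary (zdGraph 3) (box 3 L)).image (· + y))) :
    j + 1 ≤ openBdry ω X := by
  by_contra h
  apply hfloor
  refine ⟨(edgeBoundary (zdGraph 3) X).filter (· ∈ ω), by unfold openBdry at h; omega, ?_⟩
  rintro ⟨x, hx, z, hz, hxF, hzF, hr⟩
  have hzX : z ∈ X :=
    stays_of_boundary_subset hω (fun e he heω => Finset.mem_filter.2 ⟨he, heω⟩) ⟨x, hxF⟩ ⟨z, hzF⟩ hr (hAX hx)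
  exact Finset.disjoint_left.1 hXB hzX hz

/-- **Merging two pockets** (submodularity of the open cut function, `PocketResampling.openBdry_submodular`):
if `V` and `W` have at most `j` open boundary edges and `V ∩ W` has at least `j`, then `V ∪ W` has at most `j`. -/
theorem openBdry_union_le {ω : BondConfig (Site 3)} {V W : Finset (Site 3)} {j : ℕ}
    (hV : openBdry ω V ≤ j) (hW : openBdry ω W ≤ j) (hI : j ≤ openBdry ω (V ∩ W)) :
    openBdry ω (V ∪ W) ≤ j := by
  have := openBdry_submodular ω V W
  omega


/-! ## The two-sided cut: a closed shell bag with few doors blocks the centre -/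

/-- **Shell exclusion (the deterministic heart).**  Let `V` be a finite set of sites with at most `j ≥ 1` open
lattice boundary edges, disjoint from `box m`, contained in `box (L₂ - 1)`, and containing the whole sup-norm
sphere `box R ∖ box (R-1)` (`m + 1 ≤ R`, `R + 1 ≤ L₂`).  Then the annulus `box m → ∂ⁱⁿ box L₂` can be blocked
inside `box L₂` by closing at most `j - 1` edges.  Proof: split the open doors of `V` into those whose outer
endpoint lies inside the sphere and those whose outer endpoint lies outside; each class alone is a blocking set
(a lattice crossing starts inside, ends outside, and can enter or leave `V` only through a door or through the
sphere, which is inside `V`); the two classes are disjoint, so one of them has at most `⌊j/2⌋ ≤ j - 1` edges. -/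
theorem blocked_of_shell {ω : BondConfig (Site 3)} (hω : ω ⊆ (zdGraph 3).edgeSet) {j m R L₂ : ℕ}
    (hj : 1 ≤ j) (hmR : m + 1 ≤ R) (hRL : R + 1 ≤ L₂) {V : Finset (Site 3)} (hV : openBdry ω V ≤ j)
    (hVm : Disjoint V (box 3 m)) (hVL : V ⊆ box 3 (L₂ - 1))
    (hcov : ∀ x ∈ box 3 R, x ∉ box 3 (R - 1) → x ∈ V) :
    ∃ S : Finset (Sym2 (Site 3)), S.card ≤ j - 1 ∧ ¬ ∃ x ∈ box 3 m,
      ∃ z ∈ innerBoundary (zdGraph 3) (box 3 L₂), (ω \ ↑S) ∈ openConnIn ↑(box 3 L₂) x z := by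
  have hR : 1 ≤ R := by omega
  set D : Finset (Sym2 (Site 3)) := (edgeBoundary (zdGraph 3) V).filter (· ∈ ω) with hD
  set Sin : Finset (Sym2 (Site 3)) := D.filter (fun e => ∃ v ∈ e, v ∉ V ∧ v ∈ box 3 (R - 1)) with hSin
  set Sout : Finset (Sym2 (Site 3)) := D.filter (fun e => ∃ v ∈ e, v ∉ V ∧ v ∉ box 3 R) with hSout
  -- the two door classes are disjoint
  have hdisj : Disjoint Sin Sout := by
    rw [Finset.disjoint_left]
    intro e h1 h2
    rw [hSin, Finset.mem_filter] at h1
    rw [hSout, Finset.mem_filter] at h2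
    obtain ⟨heD, v, hv, hvV, hvb⟩ := h1
    obtain ⟨-, v', hv', hv'V, hv'b⟩ := h2
    by_cases hvv : v = v'
    · subst hvv
      exact hv'b (box_mono 3 (Nat.sub_le R 1) hvb)
    · have he : e = s(v, v') := (Sym2.mem_and_mem_iff hvv).1 ⟨hv, hv'⟩
      rw [hD, Finset.mem_filter] at heD
      obtain ⟨⟨-, ⟨u, huV, hue⟩, -⟩, -⟩ := (mem_edgeBoundary_iff.1 heD.1), heD
      rw [he] at hue
      rcases Sym2.mem_iff.1 hue with rfl | rfl
      · exact hvV huV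
      · exact hv'V huV
  have hcard : Sin.card + Sout.card ≤ j := by
    rw [← Finset.card_union_of_disjoint hdisj]
    refine (Finset.card_le_card (Finset.union_subset (Finset.filter_subset _ _) (Finset.filter_subset _ _))).trans ?_
    exact hV
  -- a door with inner endpoint `u ∈ V` and outer endpoint `v ∉ V` is an open door of `V`
  have hdoor : ∀ u v, u ∈ V → v ∉ V → s(u, v) ∈ ω → s(u, v) ∈ D := by
    intro u v hu hv he
    rw [hD, Finset.mem_filter]
    exact ⟨mem_edgeBoundary_iff.2 ⟨hω he, ⟨u, hu, Sym2.mem_mk_left _ _⟩, ⟨v, hv, Sym2.mem_mk_right _ _⟩⟩, he⟩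
  -- the inner doors block
  have hin : ¬ ∃ x ∈ box 3 m, ∃ z ∈ innerBoundary (zdGraph 3) (box 3 L₂),
      (ω \ ↑Sin) ∈ openConnIn ↑(box 3 L₂) x z := by
    rintro ⟨x, hx, z, hz, hxF, hzF, hr⟩
    obtain ⟨w⟩ := hr.map (SimpleGraph.Embedding.induce (↑(box 3 L₂) : Set (Site 3))).toHom
    have hxQ : x ∈ {v : Site 3 | v ∉ V ∧ v ∈ box 3 (R - 1)} :=
      ⟨fun hxV => Finset.disjoint_left.1 hVm hxV hx, box_mono 3 (by omega) hx⟩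
    have hzQ : z ∉ {v : Site 3 | v ∉ V ∧ v ∈ box 3 (R - 1)} :=
      fun h => notMem_box_of_mem_innerBoundary (by omega) hz h.2
    obtain ⟨d, -, hd1, hd2⟩ := w.exists_boundary_dart _ hxQ hzQ
    obtain ⟨a, b, ha, hb, he, heS⟩ : ∃ a b : Site 3, a ∈ {v : Site 3 | v ∉ V ∧ v ∈ box 3 (R - 1)} ∧
        b ∉ {v : Site 3 | v ∉ V ∧ v ∈ box 3 (R - 1)} ∧ s(a, b) ∈ ω ∧ s(a, b) ∉ (↑Sin : Set (Sym2 (Site 3))) :=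
      ⟨d.fst, d.snd, hd1, hd2, ((openGraph_adj _ _ _).1 d.adj).1.1, ((openGraph_adj _ _ _).1 d.adj).1.2⟩
    have hE : (zdGraph 3).Adj a b := hω he
    by_cases hsV : b ∈ V
    · apply heS
      rw [Finset.mem_coe, hSin, Finset.mem_filter]
      refine ⟨?_, a, Sym2.mem_mk_left _ _, ha.1, ha.2⟩
      have := hdoor _ _ hsV ha.1 (by rw [Sym2.eq_swap]; exact he)
      rwa [Sym2.eq_swap]
    · have hsb : b ∉ box 3 (R - 1) := fun h => hb ⟨hsV, h⟩
      exact hsV (hcov _ (mem_box_of_adj_of_mem_box_pred hR ha.2 hE) hsb)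
  -- the outer doors block
  have hout : ¬ ∃ x ∈ box 3 m, ∃ z ∈ innerBoundary (zdGraph 3) (box 3 L₂),
      (ω \ ↑Sout) ∈ openConnIn ↑(box 3 L₂) x z := by
    rintro ⟨x, hx, z, hz, hxF, hzF, hr⟩
    obtain ⟨w⟩ := hr.symm.map (SimpleGraph.Embedding.induce (↑(box 3 L₂) : Set (Site 3))).toHom
    have hzQ : z ∈ {v : Site 3 | v ∉ V ∧ v ∉ box 3 R} := by
      refine ⟨fun hzV => notMem_box_of_mem_innerBoundary (by omega) hz (hVL hzV), ?_⟩
      exact notMem_box_of_mem_innerBoundary (by omega) hz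
    have hxQ : x ∉ {v : Site 3 | v ∉ V ∧ v ∉ box 3 R} := fun h => h.2 (box_mono 3 (by omega) hx)
    obtain ⟨d, -, hd1, hd2⟩ := w.exists_boundary_dart _ hzQ hxQ
    obtain ⟨a, b, ha, hb, he, heS⟩ : ∃ a b : Site 3, a ∈ {v : Site 3 | v ∉ V ∧ v ∉ box 3 R} ∧
        b ∉ {v : Site 3 | v ∉ V ∧ v ∉ box 3 R} ∧ s(a, b) ∈ ω ∧ s(a, b) ∉ (↑Sout : Set (Sym2 (Site 3))) :=
      ⟨d.fst, d.snd, hd1, hd2, ((openGraph_adj _ _ _).1 d.adj).1.1, ((openGraph_adj _ _ _).1 d.adj).1.2⟩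
    have hE : (zdGraph 3).Adj a b := hω he
    by_cases hsV : b ∈ V
    · apply heS
      rw [Finset.mem_coe, hSout, Finset.mem_filter]
      refine ⟨?_, a, Sym2.mem_mk_left _ _, ha.1, ha.2⟩
      have := hdoor _ _ hsV ha.1 (by rw [Sym2.eq_swap]; exact he)
      rwa [Sym2.eq_swap]
    · have hsb : b ∈ box 3 R := by
        by_contra h
        exact hb ⟨hsV, h⟩
      exact hsV (hcov _ hsb (not_mem_box_pred_of_adj_of_not_mem_box hR ha.2 hE))
  by_cases hcase : Sin.card ≤ j - 1
  · exact ⟨Sin, hcase, hin⟩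
  · exact ⟨Sout, by omega, hout⟩

end ShellExclusion

open ShellExclusion in
/-- **Registered stub `stub_blockedOfShell`** of the crux skeleton (line `budget-halving`, shell form): the two-sided
cut `ShellExclusion.blocked_of_shell` in the registered raw form (the open boundary count written out as
`((edgeBoundary (zdGraph 3) V).filter (· ∈ ω)).card`).  A finite `V` with at most `j ≥ 1` open lattice boundary
edges, disjoint from `box m`, inside `box (M - 1)`, containing the sphere `box R ∖ box (R - 1)` (`m + 1 ≤ R`,
`R + 1 ≤ M`) blocks `box m → ∂ⁱⁿ box M` inside `box M` after closing at most `j - 1` edges. -/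
theorem stub_blockedOfShell :
    ∀ (j m R M : ℕ) (ω : BondConfig (Site 3)) (V : Finset (Site 3)), ω ⊆ (zdGraph 3).edgeSet →
      1 ≤ j → m + 1 ≤ R → R + 1 ≤ M → ((edgeBoundary (zdGraph 3) V).filter (· ∈ ω)).card ≤ j →
      Disjoint V (box 3 m) → V ⊆ box 3 (M - 1) → (∀ x ∈ box 3 R, x ∉ box 3 (R - 1) → x ∈ V) →
      ∃ S : Finset (Sym2 (Site 3)), S.card ≤ j - 1 ∧ ¬ ∃ x ∈ box 3 m,
        ∃ y ∈ innerBoundary (zdGraph 3) (box 3 M),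
          (ω \ (↑S : Set (Sym2 (Site 3)))) ∈ openConnIn (↑(box 3 M) : Set (Site 3)) x y :=
  fun _ _ _ _ _ _ hω hj hmR hRM hV hVm hVL hcov => blocked_of_shell hω hj hmR hRM hV hVm hVL hcov

end Summit.CriticalPhenomena.PercolationContinuityZ3.Theorems

end
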